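import Mathlib
import Summits.Ventures.PercRepro.TriangleCapCherryDiamond

/-!
# PercRepro — the windmill family `W_t` in the kernel: `K₄⁻`-free, `3t` edges, `C(2t, 2) + 2t` cherries on
`2t + 1` vertices (p3, gen 29)

The third named structure of the `k ≤ 9` cherry table (P3-TRIANGLE-CAP.md §10x(f), engine INBOX 12184) is the
windmill (friendship graph) `W_t`: `t` triangles on a common centre, with `C(k−1, 2) + (k−1)` cherries at
`(k, m) = (2t + 1, 3t)` — the rows `(5, 6) 10`, `(7, 9) 21`, `(9, 12) 36`.  This module is the family for every
`t` (the bowtie of TriangleCapBowtie is `t = 2`):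

* `windmill t : SimpleGraph (Fin (2t + 1))` — centre `0`; the leaves `2s − 1, 2s` are twins (`(i + 1) / 2`);
* `k4mFree_windmill` — a `4`-set with the centre carries `3 + 2 + 2 + 1 ≤ 8` ordered adjacent pairs (three
  distinct leaves cannot all have their twin among them: a twin class has `≤ 2` leaves), one without it `≤ 4`;
* `deg_windmill_centre = 2t`, `deg_windmill_leaf = 2`, `cherries_windmill = C(2t, 2) + 2t`,
  `sum_deg_windmill = 6t`, `card_edges_windmill = 3t`;
* **`exists_windmill_row`** — for every `t` a `K₄⁻`-free graph on `Fin (2t + 1)` with `3t` edges and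
  `C(2t, 2) + 2t` cherries; `windmill_rows_values` — the three census rows `10 / 21 / 36`.

Axioms: standard.
-/

namespace PercRepro

namespace TriangleCap

namespace C047

open Finset

/-- The windmill `W_t` on `Fin (2t + 1)`: the centre `0` is adjacent to every leaf, and the leaves `2s − 1`,
`2s` (the same `(i + 1) / 2`) are adjacent to each other. -/
def windmill (t : ℕ) : SimpleGraph (Fin (2 * t + 1)) where
  Adj i j := i ≠ j ∧ (i.val = 0 ∨ j.val = 0 ∨ (i.val + 1) / 2 = (j.val + 1) / 2)
  symm := ⟨fun i j h => by
    obtain ⟨h1, h2⟩ := h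
    refine ⟨h1.symm, ?_⟩
    rcases h2 with h | h | h
    · exact Or.inr (Or.inl h)
    · exact Or.inl h
    · exact Or.inr (Or.inr h.symm)⟩
  loopless := ⟨fun i h => h.1 rfl⟩

/-- Adjacency in the windmill is decidable. -/
instance decidableRelWindmill (t : ℕ) : DecidableRel (windmill t).Adj :=
  fun i j => inferInstanceAs (Decidable (i ≠ j ∧ (i.val = 0 ∨ j.val = 0 ∨ (i.val + 1) / 2 = (j.val + 1) / 2)))

/-- `(windmill t).Adj i j` unfolded. -/
theorem windmill_adj (t : ℕ) (i j : Fin (2 * t + 1)) :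
    (windmill t).Adj i j ↔ i ≠ j ∧ (i.val = 0 ∨ j.val = 0 ∨ (i.val + 1) / 2 = (j.val + 1) / 2) := Iff.rfl

/-- A twin class `{2s − 1, 2s}` has at most two elements: two vertices other than `u` in the class of `u`
coincide (arithmetic on `(· + 1) / 2`). -/
theorem twin_unique {t : ℕ} {u x y : Fin (2 * t + 1)}
    (hxu : x ≠ u) (hyu : y ≠ u) (hpx : (x.val + 1) / 2 = (u.val + 1) / 2)
    (hpy : (y.val + 1) / 2 = (u.val + 1) / 2) : x = y := by
  apply Fin.ext
  have hxu' : x.val ≠ u.val := fun h => hxu (Fin.ext h)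
  have hyu' : y.val ≠ u.val := fun h => hyu (Fin.ext h)
  omega

/-- The vertices of `S` with value `0`: at most one. -/
theorem card_filter_val_zero_le_one (t : ℕ) (S : Finset (Fin (2 * t + 1))) :
    (S.filter (fun x : Fin (2 * t + 1) => x.val = 0)).card ≤ 1 := by
  rw [card_le_one]
  intro a ha b hb
  rw [mem_filter] at ha hb
  exact Fin.ext (ha.2.trans hb.2.symm)

/-- The twins of a leaf `u` inside `S`: at most one. -/
theorem card_filter_twin_le_one (t : ℕ) (S : Finset (Fin (2 * t + 1))) (u : Fin (2 * t + 1)) :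
    (S.filter (fun x : Fin (2 * t + 1) => x ≠ u ∧ x.val ≠ 0 ∧ (x.val + 1) / 2 = (u.val + 1) / 2)).card ≤ 1 := by
  rw [card_le_one]
  intro a ha b hb
  rw [mem_filter] at ha hb
  exact twin_unique ha.2.1 hb.2.1 ha.2.2.2 hb.2.2.2

/-- The neighbours of a leaf `u` inside `S` are the centre (if present) and its twin (if present). -/
theorem filter_adj_windmill_leaf_subset (t : ℕ) (S : Finset (Fin (2 * t + 1))) (u : Fin (2 * t + 1))
    (hu : u.val ≠ 0) :
    S.filter (fun x => (windmill t).Adj u x) ⊆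
      S.filter (fun x : Fin (2 * t + 1) => x.val = 0) ∪
        S.filter (fun x : Fin (2 * t + 1) => x ≠ u ∧ x.val ≠ 0 ∧ (x.val + 1) / 2 = (u.val + 1) / 2) := by
  intro x hx
  rw [mem_filter, windmill_adj] at hx
  obtain ⟨hxS, hne, h⟩ := hx
  rw [mem_union, mem_filter, mem_filter]
  rcases h with h | h | h
  · exact absurd h hu
  · exact Or.inl ⟨hxS, h⟩
  · by_cases hx0 : x.val = 0
    · exact Or.inl ⟨hxS, hx0⟩
    · exact Or.inr ⟨hxS, hne.symm, hx0, h.symm⟩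

/-- A leaf has at most `2` neighbours inside any `S`. -/
theorem card_filter_adj_windmill_leaf_le_two (t : ℕ) (S : Finset (Fin (2 * t + 1))) (u : Fin (2 * t + 1))
    (hu : u.val ≠ 0) : (S.filter (fun x => (windmill t).Adj u x)).card ≤ 2 := by
  calc (S.filter (fun x => (windmill t).Adj u x)).card
      ≤ (S.filter (fun x : Fin (2 * t + 1) => x.val = 0) ∪
          S.filter (fun x : Fin (2 * t + 1) => x ≠ u ∧ x.val ≠ 0 ∧ (x.val + 1) / 2 = (u.val + 1) / 2)).card :=
        card_le_card (filter_adj_windmill_leaf_subset t S u hu)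
    _ ≤ (S.filter (fun x : Fin (2 * t + 1) => x.val = 0)).card +
          (S.filter (fun x : Fin (2 * t + 1) => x ≠ u ∧ x.val ≠ 0 ∧ (x.val + 1) / 2 = (u.val + 1) / 2)).card :=
        card_union_le _ _
    _ ≤ 1 + 1 := Nat.add_le_add (card_filter_val_zero_le_one t S) (card_filter_twin_le_one t S u)

/-- A leaf with no twin inside `S` has at most `1` neighbour inside `S`. -/
theorem card_filter_adj_windmill_leaf_le_one (t : ℕ) (S : Finset (Fin (2 * t + 1))) (u : Fin (2 * t + 1))
    (hu : u.val ≠ 0) (hno : ∀ x ∈ S, x ≠ u → x.val ≠ 0 → (x.val + 1) / 2 ≠ (u.val + 1) / 2) :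
    (S.filter (fun x => (windmill t).Adj u x)).card ≤ 1 := by
  have hempty : S.filter (fun x : Fin (2 * t + 1) => x ≠ u ∧ x.val ≠ 0 ∧ (x.val + 1) / 2 = (u.val + 1) / 2) = ∅ := by
    rw [filter_eq_empty_iff]
    intro x hx ⟨h1, h2, h3⟩
    exact hno x hx h1 h2 h3
  calc (S.filter (fun x => (windmill t).Adj u x)).card
      ≤ (S.filter (fun x : Fin (2 * t + 1) => x.val = 0) ∪
          S.filter (fun x : Fin (2 * t + 1) => x ≠ u ∧ x.val ≠ 0 ∧ (x.val + 1) / 2 = (u.val + 1) / 2)).card :=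
        card_le_card (filter_adj_windmill_leaf_subset t S u hu)
    _ = (S.filter (fun x : Fin (2 * t + 1) => x.val = 0)).card := by rw [hempty, union_empty]
    _ ≤ 1 := card_filter_val_zero_le_one t S

/-- If `S` has no centre, a leaf has at most `1` neighbour (its twin) inside `S`. -/
theorem card_filter_adj_windmill_leaf_le_one_of_no_centre (t : ℕ) (S : Finset (Fin (2 * t + 1)))
    (u : Fin (2 * t + 1)) (hu : u.val ≠ 0) (h0 : ∀ x ∈ S, x.val ≠ 0) :
    (S.filter (fun x => (windmill t).Adj u x)).card ≤ 1 := by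
  have hempty : S.filter (fun x : Fin (2 * t + 1) => x.val = 0) = ∅ := by
    rw [filter_eq_empty_iff]
    intro x hx
    exact h0 x hx
  calc (S.filter (fun x => (windmill t).Adj u x)).card
      ≤ (S.filter (fun x : Fin (2 * t + 1) => x.val = 0) ∪
          S.filter (fun x : Fin (2 * t + 1) => x ≠ u ∧ x.val ≠ 0 ∧ (x.val + 1) / 2 = (u.val + 1) / 2)).card :=
        card_le_card (filter_adj_windmill_leaf_subset t S u hu)
    _ = (S.filter (fun x : Fin (2 * t + 1) => x ≠ u ∧ x.val ≠ 0 ∧ (x.val + 1) / 2 = (u.val + 1) / 2)).card := by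
        rw [hempty, empty_union]
    _ ≤ 1 := card_filter_twin_le_one t S u

/-- The centre has at most `|S| − 1` neighbours inside `S` (all of `S` but itself). -/
theorem card_filter_adj_windmill_centre_le (t : ℕ) (S : Finset (Fin (2 * t + 1))) (c : Fin (2 * t + 1))
    (hc : c ∈ S) : (S.filter (fun x => (windmill t).Adj c x)).card ≤ S.card - 1 := by
  rw [← card_erase_of_mem hc]
  apply card_le_card
  intro x hx
  rw [mem_filter, windmill_adj] at hx
  rw [mem_erase]
  exact ⟨hx.2.1.symm, hx.1⟩

/-- Three distinct vertices cannot all have a twin among themselves (a twin class has `≤ 2` elements). -/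
theorem not_all_twins {t : ℕ} {a b c : Fin (2 * t + 1)}
    (hab : a ≠ b) (hac : a ≠ c) (hbc : b ≠ c)
    (h1 : (a.val + 1) / 2 = (b.val + 1) / 2 ∨ (a.val + 1) / 2 = (c.val + 1) / 2)
    (h2 : (b.val + 1) / 2 = (a.val + 1) / 2 ∨ (b.val + 1) / 2 = (c.val + 1) / 2)
    (h3 : (c.val + 1) / 2 = (a.val + 1) / 2 ∨ (c.val + 1) / 2 = (b.val + 1) / 2) : False := by
  have hab' : a.val ≠ b.val := fun h => hab (Fin.ext h)
  have hac' : a.val ≠ c.val := fun h => hac (Fin.ext h)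
  have hbc' : b.val ≠ c.val := fun h => hbc (Fin.ext h)
  omega

/-- **The windmill is `K₄⁻`-free.** -/
theorem k4mFree_windmill (t : ℕ) : K4mFree (windmill t) := by
  intro S hS
  rw [adjPairs_eq_sum]
  by_cases h0 : ∃ c ∈ S, c.val = 0
  · obtain ⟨c, hcS, hc0⟩ := h0
    -- `S = {c} ∪ S'`, `S'` three leaves
    have hS' : (S.erase c).card = 3 := by rw [card_erase_of_mem hcS, hS]
    obtain ⟨a, b, d, hab, had, hbd, hS'eq⟩ := card_eq_three.mp hS'
    have hS3 : S = insert c {a, b, d} := by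
      rw [← hS'eq, insert_erase hcS]
    have hca : c ∉ ({a, b, d} : Finset (Fin (2 * t + 1))) := by
      rw [← hS'eq]; exact notMem_erase c S
    have haS : a ∈ S.erase c := by rw [hS'eq]; simp
    have hbS : b ∈ S.erase c := by rw [hS'eq]; simp
    have hdS : d ∈ S.erase c := by rw [hS'eq]; simp
    have ha0 : a.val ≠ 0 := fun h => (mem_erase.mp haS).1 (Fin.ext (h.trans hc0.symm))
    have hb0 : b.val ≠ 0 := fun h => (mem_erase.mp hbS).1 (Fin.ext (h.trans hc0.symm))
    have hd0 : d.val ≠ 0 := fun h => (mem_erase.mp hdS).1 (Fin.ext (h.trans hc0.symm))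
    have hab' : a ∉ ({b, d} : Finset (Fin (2 * t + 1))) := by simp [hab, had]
    have hbd' : b ∉ ({d} : Finset (Fin (2 * t + 1))) := by simp [hbd]
    set f : Fin (2 * t + 1) → ℕ := fun u => (S.filter (fun x => (windmill t).Adj u x)).card with hf
    have hsum : ∑ u ∈ S, f u = f c + (f a + (f b + f d)) := by
      rw [hS3, sum_insert hca, sum_insert hab', sum_insert hbd', sum_singleton]
    change ∑ u ∈ S, f u ≤ 8
    rw [hsum]
    have hc : f c ≤ 3 := by
      have := card_filter_adj_windmill_centre_le t S c hcS
      rw [hS] at this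
      exact this
    have hA : f a ≤ 2 := card_filter_adj_windmill_leaf_le_two t S a ha0
    have hB : f b ≤ 2 := card_filter_adj_windmill_leaf_le_two t S b hb0
    have hD : f d ≤ 2 := card_filter_adj_windmill_leaf_le_two t S d hd0
    -- one of the three leaves has no twin in `S`
    have hone : f a ≤ 1 ∨ f b ≤ 1 ∨ f d ≤ 1 := by
      by_contra hcon
      push Not at hcon
      obtain ⟨h1, h2, h3⟩ := hcon
      -- each has a twin in `S`
      have key : ∀ u ∈ S, u.val ≠ 0 → 1 < f u →
          ∃ x ∈ S, x ≠ u ∧ x.val ≠ 0 ∧ (x.val + 1) / 2 = (u.val + 1) / 2 := by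
        intro u _ hu hlt
        by_contra hno
        push Not at hno
        exact absurd hlt (not_lt.mpr (card_filter_adj_windmill_leaf_le_one t S u hu hno))
      have hmemS : ∀ x, x ∈ S ↔ x = c ∨ x = a ∨ x = b ∨ x = d := by
        intro x; rw [hS3]; simp
      obtain ⟨x₁, hx₁S, hx₁a, hx₁0, hx₁p⟩ := key a ((hmemS a).mpr (by simp)) ha0 h1
      obtain ⟨x₂, hx₂S, hx₂b, hx₂0, hx₂p⟩ := key b ((hmemS b).mpr (by simp)) hb0 h2
      obtain ⟨x₃, hx₃S, hx₃d, hx₃0, hx₃p⟩ := key d ((hmemS d).mpr (by simp)) hd0 h3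
      have e₁ : (a.val + 1) / 2 = (b.val + 1) / 2 ∨ (a.val + 1) / 2 = (d.val + 1) / 2 := by
        rcases (hmemS x₁).mp hx₁S with rfl | rfl | rfl | rfl
        · exact absurd hc0 hx₁0
        · exact absurd rfl hx₁a
        · exact Or.inl hx₁p.symm
        · exact Or.inr hx₁p.symm
      have e₂ : (b.val + 1) / 2 = (a.val + 1) / 2 ∨ (b.val + 1) / 2 = (d.val + 1) / 2 := by
        rcases (hmemS x₂).mp hx₂S with rfl | rfl | rfl | rfl
        · exact absurd hc0 hx₂0
        · exact Or.inl hx₂p.symm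
        · exact absurd rfl hx₂b
        · exact Or.inr hx₂p.symm
      have e₃ : (d.val + 1) / 2 = (a.val + 1) / 2 ∨ (d.val + 1) / 2 = (b.val + 1) / 2 := by
        rcases (hmemS x₃).mp hx₃S with rfl | rfl | rfl | rfl
        · exact absurd hc0 hx₃0
        · exact Or.inl hx₃p.symm
        · exact Or.inr hx₃p.symm
        · exact absurd rfl hx₃d
      exact not_all_twins hab had hbd e₁ e₂ e₃
    omega
  · -- no centre in `S`: every vertex of `S` is a leaf with at most one neighbour inside `S`
    push Not at h0
    calc ∑ u ∈ S, (S.filter (fun x => (windmill t).Adj u x)).card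
        ≤ ∑ u ∈ S, 1 := sum_le_sum (fun u hu =>
          card_filter_adj_windmill_leaf_le_one_of_no_centre t S u (h0 u hu) h0)
      _ = 4 := by rw [sum_const, smul_eq_mul, hS, mul_one]
      _ ≤ 8 := by norm_num

/-- The twin of a leaf: `u + 1` for odd `u`, `u − 1` for even `u ≥ 2`. -/
def twin (t : ℕ) (u : Fin (2 * t + 1)) : Fin (2 * t + 1) :=
  if h : u.val % 2 = 1 then ⟨u.val + 1, by omega⟩ else ⟨u.val - 1, by omega⟩

/-- The twin of a leaf is a leaf in the same class, distinct from it. -/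
theorem twin_spec (t : ℕ) (u : Fin (2 * t + 1)) (hu : u.val ≠ 0) :
    (twin t u).val ≠ 0 ∧ twin t u ≠ u ∧ ((twin t u).val + 1) / 2 = (u.val + 1) / 2 := by
  unfold twin
  split_ifs with h
  · refine ⟨by simp, fun e => ?_, by simp; omega⟩
    have := congrArg Fin.val e
    simp at this
  · refine ⟨by simp; omega, fun e => ?_, by simp; omega⟩
    have := congrArg Fin.val e
    simp at this
    omega

/-- The neighbours of the centre are all the leaves. -/
theorem filter_adj_windmill_centre (t : ℕ) (c : Fin (2 * t + 1)) (hc : c.val = 0) :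
    univ.filter (fun x => (windmill t).Adj c x) = univ.erase c := by
  ext x
  rw [mem_filter, mem_erase, windmill_adj]
  constructor
  · rintro ⟨_, hne, _⟩
    exact ⟨hne.symm, mem_univ _⟩
  · rintro ⟨hne, _⟩
    exact ⟨mem_univ _, hne.symm, Or.inl hc⟩

/-- The centre has degree `2t`. -/
theorem deg_windmill_centre (t : ℕ) (c : Fin (2 * t + 1)) (hc : c.val = 0) : deg (windmill t) c = 2 * t := by
  unfold deg
  rw [filter_adj_windmill_centre t c hc, card_erase_of_mem (mem_univ _), card_univ, Fintype.card_fin]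
  omega

/-- A leaf has degree `2`: the centre and its twin. -/
theorem deg_windmill_leaf (t : ℕ) (u : Fin (2 * t + 1)) (hu : u.val ≠ 0) : deg (windmill t) u = 2 := by
  have hle : deg (windmill t) u ≤ 2 := card_filter_adj_windmill_leaf_le_two t univ u hu
  have hge : 2 ≤ deg (windmill t) u := by
    obtain ⟨h1, h2, h3⟩ := twin_spec t u hu
    have hc : (⟨0, by omega⟩ : Fin (2 * t + 1)) ∈ univ.filter (fun x => (windmill t).Adj u x) := by
      rw [mem_filter, windmill_adj]
      exact ⟨mem_univ _, fun e => hu (by rw [e]), Or.inr (Or.inl rfl)⟩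
    have hw : twin t u ∈ univ.filter (fun x => (windmill t).Adj u x) := by
      rw [mem_filter, windmill_adj]
      exact ⟨mem_univ _, h2.symm, Or.inr (Or.inr h3.symm)⟩
    have hne : (⟨0, by omega⟩ : Fin (2 * t + 1)) ≠ twin t u := fun e => h1 (by rw [← e])
    unfold deg
    exact (card_pair hne).symm.le.trans (card_le_card (insert_subset hc (singleton_subset_iff.mpr hw)))
  omega

/-- `Σ_v C(d(v), 2) = C(2t, 2) + 2t` on the windmill. -/
theorem cherries_windmill (t : ℕ) : cherries (windmill t) = (2 * t).choose 2 + 2 * t := by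
  unfold cherries
  rw [← add_sum_erase univ _ (mem_univ (⟨0, by omega⟩ : Fin (2 * t + 1)))]
  rw [deg_windmill_centre t _ rfl]
  congr 1
  have h : ∀ v ∈ univ.erase (⟨0, by omega⟩ : Fin (2 * t + 1)), (deg (windmill t) v).choose 2 = 1 := by
    intro v hv
    have hv0 : v.val ≠ 0 := fun e => (mem_erase.mp hv).1 (Fin.ext e)
    rw [deg_windmill_leaf t v hv0, Nat.choose_self]
  rw [sum_congr rfl h, sum_const, smul_eq_mul, mul_one, card_erase_of_mem (mem_univ _), card_univ,
    Fintype.card_fin]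
  omega

/-- `Σ_v d(v) = 6t` on the windmill. -/
theorem sum_deg_windmill (t : ℕ) : ∑ v, deg (windmill t) v = 6 * t := by
  rw [← add_sum_erase univ _ (mem_univ (⟨0, by omega⟩ : Fin (2 * t + 1)))]
  rw [deg_windmill_centre t _ rfl]
  have h : ∀ v ∈ univ.erase (⟨0, by omega⟩ : Fin (2 * t + 1)), deg (windmill t) v = 2 := by
    intro v hv
    have hv0 : v.val ≠ 0 := fun e => (mem_erase.mp hv).1 (Fin.ext e)
    exact deg_windmill_leaf t v hv0
  rw [sum_congr rfl h, sum_const, smul_eq_mul, card_erase_of_mem (mem_univ _), card_univ, Fintype.card_fin]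
  omega

/-- The windmill has `3t` edges (handshake). -/
theorem card_edges_windmill (t : ℕ) : (windmill t).edgeFinset.card = 3 * t := by
  have h := sum_deg_eq (windmill t)
  rw [sum_deg_windmill] at h
  omega

/-- **THE WINDMILL ROWS:** for every `t` a `K₄⁻`-free graph on `2t + 1` vertices with `3t` edges and
`C(2t, 2) + 2t` cherries. -/
theorem exists_windmill_row (t : ℕ) :
    ∃ (D : SimpleGraph (Fin (2 * t + 1))) (_ : DecidableRel D.Adj),
      K4mFree D ∧ D.edgeFinset.card = 3 * t ∧ cherries D = (2 * t).choose 2 + 2 * t :=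
  ⟨windmill t, inferInstance, k4mFree_windmill t, card_edges_windmill t, cherries_windmill t⟩

/-- The three windmill rows of the `k ≤ 9` table: `(5, 6) 10`, `(7, 9) 21`, `(9, 12) 36`. -/
theorem windmill_rows_values :
    cherries (windmill 2) = 10 ∧ cherries (windmill 3) = 21 ∧ cherries (windmill 4) = 36 := by
  rw [cherries_windmill, cherries_windmill, cherries_windmill]
  norm_num [Nat.choose_two_right]

end C047

end TriangleCap

end PercRepro
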